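import Literature.Computability.AlgebraicComplexity.ApproximativeRootClosure
import Literature.Computability.AlgebraicComplexity.IMMInVPProofs
import Mathlib.RingTheory.MvPolynomial.WeightedHomogeneous
import HarnessLib

/-!
# Initial forms are cheap border computations: `L̲(in_H f) ≤ L(f) + n + 1`
# (Bürgisser 2024 survey, Remark 4.21) — PROVED

Topic `Computability/AlgebraicComplexity`. Cell `val-lit`, row Bur2024-A (Bürgisser's 2024 survey
*Completeness classes in algebraic complexity theory*, arXiv:2406.06217), §4.7 "Closures of complexity
classes", companion of `BorderComplexityAlder.lean` (Thm. 4.20) and `BorderComplexityEuclidean.lean`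
(Thm. 4.19). Remark 4.21 of the survey links border complexity to initial ideals / Gröbner
degenerations:

> **Remark 4.21.** … The convex hull of the support `supp f` of a polynomial
> `f = Σ_{a ∈ supp f} c(a) x₁^{a₁}⋯xₙ^{aₙ}` is called the Newton polytope `P` of `f`. To a supporting
> hyperplane `H` of `P` we may assign the corresponding initial term polynomial
> `in_H f := Σ_{a ∈ H ∩ supp f} c(a) x₁^{a₁}⋯xₙ^{aₙ}`. We claim that `L̲(in_H f) ≤ L(f) + n + 1`.
> Indeed … assume that `⟨w,x⟩ - b = 0` is the equation of `H`, say `⟨w,x⟩ ≥ b` on `P`. We can always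
> achieve that `w ∈ ℤⁿ`, `b ∈ ℤ`. Then we have
> `F := ε^{-b} f(ε^{w₁}x₁,…,ε^{wₙ}xₙ) = Σ_{a ∈ supp f} c(a) ε^{⟨w,a⟩-b} x^a = in_H f + O(ε)` …
> Therefore `F_{ε=0} = in_H f` and `L(F) ≤ L(f) + n + 1` which proves our claim. (Recall that the
> powers of `ε` are considered as constants.) (held text `paper:arxiv-2406.06217`, p0021 L44–L84.)

Rendering: `in_H f` for the hyperplane `⟨w,x⟩ = b` is Mathlib's weighted homogeneous component
`weightedHomogeneousComponent w b f` (`w : σ → ℤ`, `b : ℤ`; its coefficient at `a` is `c(a)` if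
`⟨w,a⟩ = weight w a = b` and `0` otherwise); "`⟨w,x⟩ ≥ b` on `P`" is the hypothesis
`∀ a ∈ f.support, b ≤ weight w a` (on the vertices = support, equivalently on the polytope); `L̲` is
the tree's `borderComplexity` (a fan-in-two circuit over `F((ε))` computing `in_H f + O(ε)`,
`ApproximativeRootClosure.lean`), `L` the tree's `complexity`, `n = #σ`.

* `coeff_aeval_C_mul_X` — the torus rescaling `x_i ↦ u_i x_i` multiplies the coefficient of `x^a`
  by `∏ u_i^{a_i}`;
* `borderComplexity_weightedHomogeneousComponent_le` — **Remark 4.21**: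
  `borderComplexity (weightedHomogeneousComponent w b f) ≤ complexity f + Fintype.card σ + 1`
  whenever `b ≤ weight w a` for all `a ∈ f.support` (any field `F`).

The gate count is the printed one: the substitution `x_i ↦ ε^{w_i} x_i` costs one scalar gate per
variable (`complexity_aeval_le`, `complexity_smul_le`), the final scaling by `ε^{-b}` one more.
Theorems only; 0 definitions, 0 named facts. Honest framing: an elementary remark re-proved;
nothing here bears on `VP ≠ VNP`, which is NOT proved.

## References

* [Burgisser2024Completeness] P. Bürgisser, arXiv:2406.06217 (2024), §4.7, Remark 4.21
  (held text p0021 L44–L84).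
* [Burgisser2004Factors] P. Bürgisser, Found. Comput. Math. 4 (2004), Def. 2.1 (`L̲`).
-/

noncomputable section

open MvPolynomial

namespace Literature.Computability.AlgebraicComplexity

universe u v

section Rescaling

variable {R : Type u} [CommSemiring R] {σ : Type v}

/-- **Torus rescaling of the variables acts diagonally on coefficients**: substituting
`x_i ↦ u_i · x_i` multiplies the coefficient of `x^a` by `∏_i u_i^{a_i}` (the computation
`f(ε^{w₁}x₁,…,ε^{wₙ}xₙ) = Σ_a c(a) ε^{⟨w,a⟩} x^a` of Remark 4.21).
[cite: Burgisser2024Completeness, Remark 4.21 (§4.7, p0021 L74–L79)] -/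
theorem coeff_aeval_C_mul_X (u : σ → R) (p : MvPolynomial σ R) (a : σ →₀ ℕ) :
    coeff a (aeval (fun i => C (u i) * X i) p) = (a.prod fun i e => u i ^ e) * coeff a p := by
  classical
  induction p using MvPolynomial.induction_on' with
  | monomial s c =>
    have hprod : (s.prod fun i e => (C (u i) * X i : MvPolynomial σ R) ^ e) =
        C (s.prod fun i e => u i ^ e) * s.prod fun i e => (X i : MvPolynomial σ R) ^ e := by
      simp only [Finsupp.prod, mul_pow, ← map_pow, Finset.prod_mul_distrib, map_prod]
    rw [aeval_monomial, hprod, ← monomial_eq, algebraMap_eq, C_mul_monomial, coeff_monomial,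
      coeff_monomial]
    by_cases h : s = a
    · subst h
      simp [mul_comm]
    · simp [h]
  | add p q hp hq => rw [map_add, coeff_add, coeff_add, hp, hq, mul_add]

end Rescaling

section InitialForms

variable {F : Type u} [Field F] {σ : Type v}

/-- Powers of `ε` in `F((ε))`: `∏_i (ε^{w_i})^{a_i} = ε^{⟨w,a⟩}`. [cite: Burgisser2024Completeness, Remark 4.21 (§4.7, p0021 L74–L79)] -/
private theorem prod_single_pow_eq_single_weight (w : σ → ℤ) (a : σ →₀ ℕ) :
    (a.prod fun i e => (HahnSeries.single (w i) (1 : F) : LaurentSeries F) ^ e) =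
      HahnSeries.single (Finsupp.weight w a) 1 := by
  classical
  rw [Finsupp.weight_apply, Finsupp.prod, Finsupp.sum]
  induction a.support using Finset.induction_on with
  | empty => simp
  | insert i s hi ih =>
    rw [Finset.prod_insert hi, Finset.sum_insert hi, ih, HahnSeries.single_pow, one_pow,
      HahnSeries.single_mul_single, one_mul]

/-- **Bürgisser 2024, Remark 4.21 — PROVED: `L̲(in_H f) ≤ L(f) + n + 1`.** For a weight vector
`w ∈ ℤ^σ` and `b ∈ ℤ` with `⟨w,a⟩ ≥ b` on the support of `f` (i.e. on its Newton polytope), the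
initial form `in_H f = Σ_{⟨w,a⟩ = b} c(a) x^a` (Mathlib's `weightedHomogeneousComponent w b f`) has
border complexity at most `complexity f + #σ + 1`: over `F((ε))`,
`F := ε^{-b} f(ε^{w₁}x₁,…,ε^{wₙ}xₙ) = in_H f + O(ε)` and `L(F) ≤ L(f) + n + 1`.
[cite: Burgisser2024Completeness, Remark 4.21 (§4.7, p0021 L44–L84)] -/
theorem borderComplexity_weightedHomogeneousComponent_le [Fintype σ] (f : MvPolynomial σ F)
    (w : σ → ℤ) (b : ℤ) (hb : ∀ a ∈ f.support, b ≤ Finsupp.weight w a) :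
    borderComplexity (weightedHomogeneousComponent w b f) ≤ complexity f + Fintype.card σ + 1 := by
  classical
  -- the rescaled polynomial `g = f(ε^{w} x)` and `h = ε^{-b} g` over `K = F((ε))`
  set K := LaurentSeries F
  let u : σ → K := fun i => HahnSeries.single (w i) 1
  let fK : MvPolynomial σ K := MvPolynomial.map (algebraMap F K) f
  let g : MvPolynomial σ K := aeval (fun i => C (u i) * X i) fK
  let h : MvPolynomial σ K := (HahnSeries.single (-b) (1 : F) : K) • g
  -- gate count: `L(h) ≤ L(g) + 1 ≤ L(f) + Σ_i L(ε^{w_i} x_i) + 1 ≤ L(f) + n + 1`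
  have hθ : ∀ i, complexity (C (u i) * X i : MvPolynomial σ K) ≤ 1 := fun i => by
    rw [← smul_eq_C_mul]
    refine (complexity_smul_le_holds _ _).trans ?_
    rw [complexity_X_holds]
  have hg : complexity g ≤ complexity f + Fintype.card σ := by
    refine (complexity_aeval_le fK _).trans (Nat.add_le_add (ArithCircuit.complexity_map_le _ f) ?_)
    calc ∑ i, complexity (C (u i) * X i : MvPolynomial σ K) ≤ ∑ _i : σ, 1 :=
          Finset.sum_le_sum fun i _ => hθ i
      _ = Fintype.card σ := by simp
  have hh : complexity h ≤ complexity f + Fintype.card σ + 1 :=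
    (complexity_smul_le_holds _ _).trans (Nat.add_le_add_right hg 1)
  -- coefficients: `coeff_a h = c(a) ε^{⟨w,a⟩ - b}`
  have hcoeff : ∀ a, coeff a h = HahnSeries.single (Finsupp.weight w a - b) (coeff a f) := by
    intro a
    dsimp only [h, g, fK, u]
    rw [coeff_smul, smul_eq_mul, coeff_aeval_C_mul_X, prod_single_pow_eq_single_weight, coeff_map,
      algebraMap_laurentSeries_apply, HahnSeries.C_apply, HahnSeries.single_mul_single,
      HahnSeries.single_mul_single, one_mul, one_mul,
      show -b + (Finsupp.weight w a + 0) = Finsupp.weight w a - b by omega]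
  -- `h = in_H f + O(ε)`
  refine (borderComplexity_le_of_polyOrdGE h fun a => ?_).trans hh
  rw [coeff_sub, hcoeff, coeff_map, coeff_weightedHomogeneousComponent,
    algebraMap_laurentSeries_apply, HahnSeries.C_apply]
  by_cases hmem : a ∈ f.support
  · by_cases heq : Finsupp.weight w a = b
    · rw [if_pos heq, heq, sub_self b, sub_self]
      exact IsOrdGE.zero 1
    · have hlt : 1 ≤ Finsupp.weight w a - b := by
        have := hb a hmem
        omega
      rw [if_neg heq, HahnSeries.single_eq_zero, sub_zero]
      exact (IsOrdGE.single _ _).mono hlt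
  · rw [notMem_support_iff.mp hmem]
    simp only [HahnSeries.single_eq_zero, ite_self, sub_zero]
    exact IsOrdGE.zero 1

end InitialForms

end Literature.Computability.AlgebraicComplexity

end
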